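import Mathlib
import Literature.Computability.MetaComplexity.SmolenskyDimensionBound

/-!
# A subspace of `𝔽₂`-valued functions on the cube has an element of large support

A subspace `A` of `𝔽₂`-valued functions on the cube `{0,1}ⁿ` contains an element supported on at
least half its dimension many points — averaging over a binary linear code: let `U` be the set
of coordinates where `A` is not identically zero; then `A ⊆ 𝔽₂^U`, so `dim A ≤ |U|`, and for
each `b ∈ U` at least half of the elements of `A` are nonzero at `b` (translation by some
`g₀ ∈ A` with `g₀(b) ≠ 0` injects `{g ∈ A : g(b) = 0}` into `{g ∈ A : g(b) ≠ 0}`), so the average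
support size over `A` is at least `|U| / 2 ≥ dim A / 2`. Wave-2 support of line Sketch/LAR, crux
stmt-QuantumAdvantage-1392: the inverse direction "large annihilator rank ⇒ dense one-sided
certifier".
-/

namespace Summit.QuantumAdvantage.DigitPolyUniformity.SketchLAR

open Finset Module
open Literature.Computability.MetaComplexity.Smolensky (CubeFn mono lowDeg)

namespace ExistsDense

/-- At a coordinate `b` where some `g₀ ∈ A` is nonzero, at least half of the elements of `A` are
nonzero: `g ↦ g + g₀` injects `{g ∈ A : g b = 0}` into `{g ∈ A : g b ≠ 0}`. [folklore] -/
theorem card_le_two_mul_card_filter {n : ℕ} (A : Submodule (ZMod 2) (CubeFn (ZMod 2) n))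
    [Fintype ↥A] {g₀ : CubeFn (ZMod 2) n} (hg₀ : g₀ ∈ A) {b : Fin n → Bool} (hb : g₀ b ≠ 0) :
    Fintype.card ↥A ≤ 2 * (univ.filter fun g : ↥A => (g : CubeFn (ZMod 2) n) b ≠ 0).card := by
  have hsplit := Finset.card_filter_add_card_filter_not (s := (univ : Finset ↥A))
    (fun g : ↥A => (g : CubeFn (ZMod 2) n) b ≠ 0)
  have hinj : (univ.filter fun g : ↥A => ¬ (g : CubeFn (ZMod 2) n) b ≠ 0).card ≤
      (univ.filter fun g : ↥A => (g : CubeFn (ZMod 2) n) b ≠ 0).card := by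
    refine Finset.card_le_card_of_injOn (fun g => g + ⟨g₀, hg₀⟩) (fun g hg => ?_) ?_
    · simp only [Finset.mem_coe, Finset.mem_filter, Finset.mem_univ, true_and, not_not] at hg ⊢
      rw [Submodule.coe_add, Pi.add_apply, hg, zero_add]
      exact hb
    · exact fun x _ y _ hxy => add_right_cancel hxy
  rw [Finset.card_univ] at hsplit
  omega

/-- Double counting: the total support size of the elements of `A` is the sum over the
coordinates `b` of the number of elements of `A` that are nonzero at `b`. [folklore] -/
theorem sum_card_filter_comm {n : ℕ} (A : Submodule (ZMod 2) (CubeFn (ZMod 2) n))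
    [Fintype ↥A] :
    ∑ g : ↥A, (univ.filter fun b : Fin n → Bool => (g : CubeFn (ZMod 2) n) b ≠ 0).card =
      ∑ b : Fin n → Bool, (univ.filter fun g : ↥A => (g : CubeFn (ZMod 2) n) b ≠ 0).card := by
  simp only [Finset.card_filter]
  exact Finset.sum_comm

/-- Averaging: if `A` is not identically zero at any coordinate of `U`, then some element of `A`
is nonzero on at least `|U| / 2` coordinates (the average support size over `A` is at least
`|U| / 2`). [folklore] -/
theorem exists_card_le_two_mul {n : ℕ} (A : Submodule (ZMod 2) (CubeFn (ZMod 2) n))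
    [Fintype ↥A] (U : Finset (Fin n → Bool)) (hU : ∀ b ∈ U, ∃ g ∈ A, g b ≠ 0) :
    ∃ g : ↥A,
      U.card ≤ 2 * (univ.filter fun b : Fin n → Bool => (g : CubeFn (ZMod 2) n) b ≠ 0).card := by
  have key : ∀ b ∈ U, Fintype.card ↥A ≤
      2 * (univ.filter fun g : ↥A => (g : CubeFn (ZMod 2) n) b ≠ 0).card := fun b hb => by
    obtain ⟨g₀, hg₀, hb0⟩ := hU b hb
    exact card_le_two_mul_card_filter A hg₀ hb0
  have hsum : ∑ _g : ↥A, U.card ≤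
      ∑ g : ↥A, 2 * (univ.filter fun b : Fin n → Bool => (g : CubeFn (ZMod 2) n) b ≠ 0).card :=
    calc ∑ _g : ↥A, U.card = ∑ _b ∈ U, Fintype.card ↥A := by
          simp only [Finset.sum_const, Finset.card_univ, smul_eq_mul]
          ring
      _ ≤ ∑ b ∈ U, 2 * (univ.filter fun g : ↥A => (g : CubeFn (ZMod 2) n) b ≠ 0).card :=
          Finset.sum_le_sum key
      _ ≤ ∑ b, 2 * (univ.filter fun g : ↥A => (g : CubeFn (ZMod 2) n) b ≠ 0).card :=
          Finset.sum_le_sum_of_subset_of_nonneg (Finset.subset_univ U) fun _ _ _ => Nat.zero_le _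
      _ = ∑ g : ↥A,
            2 * (univ.filter fun b : Fin n → Bool => (g : CubeFn (ZMod 2) n) b ≠ 0).card := by
          rw [← Finset.mul_sum, ← Finset.mul_sum, sum_card_filter_comm]
  obtain ⟨g, -, hg⟩ :=
    Finset.exists_le_of_sum_le (⟨0, Finset.mem_univ _⟩ : (univ : Finset ↥A).Nonempty) hsum
  exact ⟨g, hg⟩

end ExistsDense

/-- **Dense elements of a subspace**: a subspace `A` of `𝔽₂`-valued functions on the cube
contains an element `h` supported on at least `dim A / 2` points (with `U` the set of coordinates
where `A` is not identically zero, `dim A ≤ |U|` and the average support size over `A` is at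
least `|U| / 2`). [folklore] -/
theorem stub_exists_dense {n : ℕ} (A : Submodule (ZMod 2) (CubeFn (ZMod 2) n)) :
    ∃ h ∈ A, Module.finrank (ZMod 2) ↥A ≤ 2 * (univ.filter fun b => h b ≠ 0).card := by
  classical
  obtain ⟨g, hg⟩ := ExistsDense.exists_card_le_two_mul A
    (univ.filter fun b => ∃ g ∈ A, g b ≠ 0) fun b hb => (Finset.mem_filter.1 hb).2
  have hle : A ≤ Literature.Computability.MetaComplexity.Smolensky.suppOn (ZMod 2)
      (univ.filter fun b => ∃ g ∈ A, g b ≠ 0) := fun f hf =>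
    Literature.Computability.MetaComplexity.Smolensky.mem_suppOn_of_forall fun b hb => by
      by_contra h0
      exact hb (Finset.mem_filter.2 ⟨Finset.mem_univ _, f, hf, h0⟩)
  exact ⟨g, g.2, ((Submodule.finrank_mono hle).trans
    (Literature.Computability.MetaComplexity.Smolensky.finrank_suppOn_le _)).trans hg⟩

end Summit.QuantumAdvantage.DigitPolyUniformity.SketchLAR
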